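import Literature.Analysis.FluidPDE.VanishingDiffusivitySelectionBV
import Literature.Analysis.FunctionSpaces.TorusCalculusProofs
import HarnessLib

/-!
# Mescolini–Pitcho–Sorella 2025: proved bookkeeping for `VanishingDiffusivitySelectionBV.lean`

Companion (theorems only, no new facts) of `Literature/Analysis/FluidPDE/VanishingDiffusivitySelectionBV.lean`
(G. Mescolini, J. Pitcho, M. Sorella, Ann. Mat. Pura Appl. (4) 204 (2025) 1667–1687, Thm. 1.4, Thm. 2.4).

* Projections of the clause predicates (`IsBoundedEnergySolution → IsBoundedWeakSolution →
  Torus.IsWeakScalarTransportOn`).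
* `IsVanishingDiffusivitySolution.exists_isScalarLimitPoint`: a vanishing diffusivity solution in the
  sense of Def. 1.2 is a weak-* limit point of scalar solutions along a vanishing sequence of
  diffusivities in the sense of Colombo–Crippa–Sorella (`Torus.IsScalarLimitPoint`, the notion in which
  `ColomboCrippaSorella2023_thmB` states LACK of selection) — so Thm. 1.4 and CCS Thm. B speak about
  the same objects.
* `MescoliniPitchoSorella2025_thm14.not_hasAnomalousScalarDissipation`: Thm. 1.4 (ii) together with the
  existence part of Thm. 2.4 refutes the tree's `Torus.HasAnomalousScalarDissipation T b ρ_in`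
  (Colombo–Crippa–Sorella (1.5): `limsup_{κ→0} κ∫₀ᵀ‖∇ϑ_κ‖² > 0` over all weak solutions) for every
  bounded datum: fields of class `L¹_loc((0,T]; BV) ∩ L²` are not anomalous scalar dissipators.
* Non-vacuity of the hypotheses: the total variation of the zero field vanishes
  (`torusTotalVariation_zero`), the zero drift satisfies every hypothesis of Thm. 1.4
  (`driftHypotheses_zero`), and standard mollifiers exist (`exists_isStandardMollifier`, a normed bump
  centred in the unit cube).
* Smooth fields are `BV` (Evans–Gariepy §5.1, first Example: `∫ f div φ = -∫ Df·φ ≤ ∫|Df|`, so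
  `W^{1,1} ⊂ BV`): `torusTotalVariation_le_of_isSmooth` (`|Dv|(T^d) ≤ ∫ (∑ᵢ‖∇vᵢ‖²)^{1/2}` for smooth
  `v`, by the tree's torus integration by parts `Torus.integral_inner_gradient_eq_neg_integral_mul_divergence_holds`
  and Cauchy–Schwarz), `torusTotalVariation_lt_top_of_isSmooth`, and the time-integrated form
  `lintegral_torusTotalVariation_le_of_isSmooth` — so the `L¹_loc((0,T]; BV)` hypothesis of Thm. 1.4 is
  met by every field smooth in `x` at each time with `∫_a^T ∫ |∇b| < ∞`.

## References

* G. Mescolini, J. Pitcho, M. Sorella, Ann. Mat. Pura Appl. (4) 204 (2025) 1667–1687, Thm. 1.4 p. 1669,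
  Thm. 2.4 p. 1671. [`MescoliniPitchoSorella2025`]
* M. Colombo, G. Crippa, M. Sorella, Ann. PDE 9 (2023) Paper 21, (1.5) p. 3, Thm. B p. 6.
  [`ColomboCrippaSorella2023`]
* L. C. Evans, R. F. Gariepy, *Measure Theory and Fine Properties of Functions*, revised ed., CRC 2015,
  §5.1 (definition of `‖Df‖(V)` and the first Example, `W^{1,1}_loc ⊂ BV_loc`). [`EvansGariepy2015`]
-/

open MeasureTheory Set Filter Topology Function Metric
open scoped ENNReal NNReal RealInnerProductSpace

namespace Literature.Analysis.FluidPDE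

noncomputable section

open Literature.Analysis.FunctionSpaces Literature.Barriers.AnomalousDissipation

namespace MescoliniPitchoSorella2025

variable {d : Type} [Fintype d]
variable {T ν : ℝ} {b : ℝ → UnitAddTorus d → EuclideanSpace ℝ d} {ρin : UnitAddTorus d → ℝ}
  {ρ : ℝ → UnitAddTorus d → ℝ}

/-! ### Projections -/

/-- A bounded weak solution is a weak solution in the tree's sense. [cite: MescoliniPitchoSorella2025, Def. 2.3 p. 1671] -/
theorem IsBoundedWeakSolution.isWeakScalarTransportOn (h : IsBoundedWeakSolution T ν b ρin ρ) :
    Torus.IsWeakScalarTransportOn T ν b ρin ρ :=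
  h.1

/-- A bounded weak solution is essentially bounded on `(0,T) × T^d`. [cite: MescoliniPitchoSorella2025, Def. 2.3 p. 1671] -/
theorem IsBoundedWeakSolution.memLp (h : IsBoundedWeakSolution T ν b ρin ρ) :
    MemLp (uncurry ρ) ∞ (Torus.slabMeasure d T) :=
  h.2

/-- The class of Thm. 2.4 consists of bounded weak solutions. [cite: MescoliniPitchoSorella2025, Thm. 2.4 p. 1671] -/
theorem IsBoundedEnergySolution.isBoundedWeakSolution (h : IsBoundedEnergySolution T ν b ρin ρ) :
    IsBoundedWeakSolution T ν b ρin ρ :=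
  h.1

/-- The class of Thm. 2.4 consists of weak solutions. [cite: MescoliniPitchoSorella2025, Thm. 2.4 p. 1671] -/
theorem IsBoundedEnergySolution.isWeakScalarTransportOn (h : IsBoundedEnergySolution T ν b ρin ρ) :
    Torus.IsWeakScalarTransportOn T ν b ρin ρ :=
  h.1.1

/-- The class of Thm. 2.4 is `L²_t Ḣ¹_x`: `∫₀ᵀ ‖∇ρ(t)‖² dt < ∞`. [cite: MescoliniPitchoSorella2025, Thm. 2.4 p. 1671] -/
theorem IsBoundedEnergySolution.lintegral_lt_top (h : IsBoundedEnergySolution T ν b ρin ρ) :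
    ∫⁻ t in Ioo 0 T, Torus.eScalarGradNormSq (ρ t) < ∞ :=
  h.2

/-- A vanishing diffusivity solution is bounded on the slab. [cite: MescoliniPitchoSorella2025, Def. 1.2 p. 1668] -/
theorem IsVanishingDiffusivitySolution.memLp (h : IsVanishingDiffusivitySolution T b ρin ρ) :
    MemLp (uncurry ρ) ∞ (Torus.slabMeasure d T) :=
  h.1

/-! ### Vanishing diffusivity solutions are Colombo–Crippa–Sorella limit points -/

/-- **Def. 1.2 versus Colombo–Crippa–Sorella.** A vanishing diffusivity solution along `b` with datum
`ρ_in` is a weak-* limit point, in the sense of `Torus.IsScalarLimitPoint` (constant drift `b`,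
diffusivities `νᵢ`), of weak solutions along a sequence of positive diffusivities `νᵢ → 0` — the notion
in which `ColomboCrippaSorella2023_thmB` asserts TWO distinct limit points. [cite: MescoliniPitchoSorella2025, Def. 1.2 p. 1668; ColomboCrippaSorella2023, Thm. B p. 6] -/
theorem IsVanishingDiffusivitySolution.exists_isScalarLimitPoint
    (h : IsVanishingDiffusivitySolution T b ρin ρ) :
    ∃ ν : ℕ → ℝ, (∀ i, 0 < ν i) ∧ Tendsto ν atTop (𝓝 0) ∧
      Torus.IsScalarLimitPoint T (fun _ => b) ν ρin ρ := by
  obtain ⟨-, ν, hν, -, hν0, ϱ, hϱ, hconv⟩ := h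
  exact ⟨ν, fun i => (hν i).1, hν0, ϱ, fun i => (hϱ i).1.1, hconv⟩

/-! ### Non-vacuity -/

/-- The zero field is weakly divergence free. [cite: MescoliniPitchoSorella2025, Thm. 1.4 p. 1669 (hypotheses; trivial instance)] -/
theorem isWeaklyDivFree_zero : Torus.IsWeaklyDivFree (0 : UnitAddTorus d → EuclideanSpace ℝ d) :=
  fun θ _ => by simp

/-- The total variation `|D0|(T^d)` of the zero field vanishes. [cite: EvansGariepy2015, §5.1 (definition of ‖Df‖; trivial instance)] -/
theorem torusTotalVariation_zero [DecidableEq d] :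
    torusTotalVariation (0 : UnitAddTorus d → EuclideanSpace ℝ d) = 0 := by
  simp [torusTotalVariation]

/-- **The zero drift satisfies every hypothesis of Thm. 1.4**: it is square integrable on the slab,
weakly divergence free at every time, and `∫_a^T |D0|(T^d) dt = 0 < ∞`. [cite: MescoliniPitchoSorella2025, Thm. 1.4 p. 1669 (hypotheses; trivial instance)] -/
theorem driftHypotheses_zero [DecidableEq d] (T : ℝ) :
    MemLp (uncurry (0 : ℝ → UnitAddTorus d → EuclideanSpace ℝ d)) 2 (Torus.slabMeasure d T) ∧
    (∀ᵐ t ∂(volume.restrict (Ioo 0 T)),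
      Torus.IsWeaklyDivFree ((0 : ℝ → UnitAddTorus d → EuclideanSpace ℝ d) t)) ∧
    (∀ a : ℝ, 0 < a → a < T →
      ∫⁻ t in Icc a T, torusTotalVariation ((0 : ℝ → UnitAddTorus d → EuclideanSpace ℝ d) t) < ∞) := by
  refine ⟨?_, Eventually.of_forall fun _ => isWeaklyDivFree_zero, fun a _ _ => ?_⟩
  · exact (MemLp.zero' : MemLp (fun _ : ℝ × UnitAddTorus d => (0 : EuclideanSpace ℝ d)) 2 _)
  · simp [torusTotalVariation_zero]

/-- **Standard mollifiers exist**: the normed bump of inner radius `1/8`, outer radius `1/4` centred at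
the centre `(½,…,½)` of the unit cube is smooth, nonnegative, has unit mass and compact support
`B̄((½,…,½), 1/4) ⊂ (0,1)^d`. [cite: MescoliniPitchoSorella2025, p. 1669 (standard mollifiers; an instance)] -/
theorem exists_isStandardMollifier : ∃ w : EuclideanSpace ℝ d → ℝ, IsStandardMollifier w := by
  classical
  let c : EuclideanSpace ℝ d := WithLp.toLp 2 fun _ => (1 / 2 : ℝ)
  let f : ContDiffBump c := ⟨1 / 8, 1 / 4, by norm_num, by norm_num⟩
  refine ⟨f.normed volume, f.contDiff_normed, f.hasCompactSupport_normed, ?_, f.nonneg_normed,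
    f.integral_normed⟩
  intro v hv i
  rw [f.tsupport_normed_eq, mem_closedBall] at hv
  have h1 : |v i - c i| ≤ dist v c := by
    have := PiLp.dist_apply_le v c i
    rwa [Real.dist_eq] at this
  have h2 : dist v c ≤ 1 / 4 := hv
  have hc : c i = 1 / 2 := rfl
  rw [hc] at h1
  constructor <;> [linarith [(abs_le.1 (h1.trans h2)).1]; linarith [(abs_le.1 (h1.trans h2)).2]]

/-! ### Smooth fields are `BV` -/

/-- **Smooth fields have finite total variation, `|Dv|(T^d) ≤ ∫_{T^d} (∑ᵢ ‖∇vᵢ‖²)^{1/2}`**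
(Evans–Gariepy §5.1, first Example: for `f ∈ W^{1,1}` and `|φ| ≤ 1`, `∫ f div φ = -∫ Df·φ ≤ ∫ |Df|`;
here componentwise on the torus, with the tree's integration by parts
`Torus.integral_inner_gradient_eq_neg_integral_mul_divergence_holds` and Cauchy–Schwarz in `ℝ^d` and
over `i`). [cite: EvansGariepy2015, §5.1, first Example (W^{1,1} ⊂ BV)] -/
theorem torusTotalVariation_le_of_isSmooth [DecidableEq d] {v : UnitAddTorus d → EuclideanSpace ℝ d}
    (hv : Torus.IsSmooth v) :
    torusTotalVariation v ≤
      ENNReal.ofReal (∫ x, √(∑ i, ‖Torus.gradient (fun y => v y i) x‖ ^ 2)) := by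
  have hvi : ∀ i, Torus.IsSmooth (fun y => v y i) := fun i => hv.apply i
  refine iSup_le fun Φ => iSup_le fun hΦ => iSup_le fun hΦ1 => ENNReal.ofReal_le_ofReal ?_
  have hint : ∀ i, Integrable (fun x => v x i * Torus.divergence (Φ i) x) volume := fun i =>
    ((hvi i).continuous.mul (hΦ i).divergence.continuous).integrable_unitAddTorus
  have hinner : ∀ i,
      Integrable (fun x => ⟪Φ i x, Torus.gradient (fun y => v y i) x⟫) volume := fun i =>
    ((hΦ i).continuous.inner (hvi i).gradient.continuous).integrable_unitAddTorus
  have hibp : ∀ i, ∫ x, v x i * Torus.divergence (Φ i) x =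
      -∫ x, ⟪Φ i x, Torus.gradient (fun y => v y i) x⟫ := by
    intro i
    rw [Torus.integral_inner_gradient_eq_neg_integral_mul_divergence_holds (hΦ i) (hvi i), neg_neg]
  have hsqrt : Continuous fun x => √(∑ i, ‖Torus.gradient (fun y => v y i) x‖ ^ 2) :=
    Real.continuous_sqrt.comp
      (continuous_finsetSum _ fun i _ => ((hvi i).gradient.continuous.norm).pow 2)
  have hpt : ∀ x, ‖∑ i, ⟪Φ i x, Torus.gradient (fun y => v y i) x⟫‖ ≤
      √(∑ i, ‖Torus.gradient (fun y => v y i) x‖ ^ 2) := by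
    intro x
    calc ‖∑ i, ⟪Φ i x, Torus.gradient (fun y => v y i) x⟫‖
        ≤ ∑ i, ‖⟪Φ i x, Torus.gradient (fun y => v y i) x⟫‖ := norm_sum_le _ _
      _ ≤ ∑ i, ‖Φ i x‖ * ‖Torus.gradient (fun y => v y i) x‖ :=
          Finset.sum_le_sum fun i _ => norm_inner_le_norm _ _
      _ ≤ √(∑ i, ‖Φ i x‖ ^ 2) * √(∑ i, ‖Torus.gradient (fun y => v y i) x‖ ^ 2) :=
          Real.sum_mul_le_sqrt_mul_sqrt _ _ _
      _ ≤ 1 * √(∑ i, ‖Torus.gradient (fun y => v y i) x‖ ^ 2) := by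
          gcongr
          calc √(∑ i, ‖Φ i x‖ ^ 2) ≤ √1 := Real.sqrt_le_sqrt (hΦ1 x)
            _ = 1 := Real.sqrt_one
      _ = √(∑ i, ‖Torus.gradient (fun y => v y i) x‖ ^ 2) := one_mul _
  calc ∫ x, ∑ i, v x i * Torus.divergence (Φ i) x
      = ∑ i, ∫ x, v x i * Torus.divergence (Φ i) x := integral_finsetSum _ fun i _ => hint i
    _ = ∑ i, -∫ x, ⟪Φ i x, Torus.gradient (fun y => v y i) x⟫ :=
        Finset.sum_congr rfl fun i _ => hibp i
    _ = -∫ x, ∑ i, ⟪Φ i x, Torus.gradient (fun y => v y i) x⟫ := by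
        rw [integral_finsetSum _ fun i _ => hinner i, Finset.sum_neg_distrib]
    _ ≤ ‖∫ x, ∑ i, ⟪Φ i x, Torus.gradient (fun y => v y i) x⟫‖ := by
        rw [Real.norm_eq_abs]; exact neg_le_abs _
    _ ≤ ∫ x, ‖∑ i, ⟪Φ i x, Torus.gradient (fun y => v y i) x⟫‖ := norm_integral_le_integral_norm _
    _ ≤ ∫ x, √(∑ i, ‖Torus.gradient (fun y => v y i) x‖ ^ 2) :=
        integral_mono_of_nonneg (Eventually.of_forall fun x => norm_nonneg _)
          hsqrt.integrable_unitAddTorus (Eventually.of_forall hpt)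

/-- **Smooth fields are `BV(T^d; ℝ^d)`**: `|Dv|(T^d) < ∞` for smooth `v`. [cite: EvansGariepy2015, §5.1, first Example (W^{1,1} ⊂ BV)] -/
theorem torusTotalVariation_lt_top_of_isSmooth [DecidableEq d] {v : UnitAddTorus d → EuclideanSpace ℝ d}
    (hv : Torus.IsSmooth v) : torusTotalVariation v < ∞ :=
  (torusTotalVariation_le_of_isSmooth hv).trans_lt ENNReal.ofReal_lt_top

/-- **The `L¹_loc((0,T]; BV)` hypothesis of Thm. 1.4 for fields smooth in `x`**: if `b(t)` is smooth for
every `t`, then `∫_a^T |Db(t)|(T^d) dt ≤ ∫_a^T ∫_{T^d} (∑ᵢ ‖∇bᵢ(t)‖²)^{1/2} dt` (lower integrals), so the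
hypothesis holds as soon as the right-hand side is finite. [cite: EvansGariepy2015, §5.1, first Example (W^{1,1} ⊂ BV); MescoliniPitchoSorella2025, Thm. 1.4 p. 1669 (hypothesis)] -/
theorem lintegral_torusTotalVariation_le_of_isSmooth [DecidableEq d]
    {b : ℝ → UnitAddTorus d → EuclideanSpace ℝ d} (hb : ∀ t, Torus.IsSmooth (b t)) (a T : ℝ) :
    ∫⁻ t in Icc a T, torusTotalVariation (b t) ≤
      ∫⁻ t in Icc a T, ENNReal.ofReal (∫ x, √(∑ i, ‖Torus.gradient (fun y => b t y i) x‖ ^ 2)) :=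
  lintegral_mono fun t => torusTotalVariation_le_of_isSmooth (hb t)

end MescoliniPitchoSorella2025

/-! ### Thm. 1.4 (ii) ⇒ no anomalous scalar dissipation in the tree's sense -/

open MescoliniPitchoSorella2025 in
/-- **Fields of class `L¹_loc((0,T]; BV) ∩ L²` are not anomalous scalar dissipators.** Under the
hypotheses of Thm. 1.4 — `T > 0`, `b ∈ L²((0,T) × T^d)` weakly divergence free at a.e. time with
`∫_a^T |Db(t)|(T^d) dt < ∞` for all `a ∈ (0,T)`, `ρ_in ∈ L^∞(T^d)` — the tree's
`Torus.HasAnomalousScalarDissipation T b ρ_in` (Colombo–Crippa–Sorella (1.5): some `ε > 0` bounds from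
below, for `κ` arbitrarily close to `0⁺`, the dissipation `κ∫₀ᵀ‖∇θ‖²` of EVERY weak solution with
diffusivity `κ`) fails: by Thm. 2.4 (existence) pick for each `κ > 0` a solution `ρ^κ` in the class
`L^∞ ∩ L²_t H¹_x`; by Thm. 1.4 (ii) its dissipation tends to `0` as `κ ↓ 0`, so it is eventually `< ε`,
contradicting the frequent lower bound. [cite: MescoliniPitchoSorella2025, Thm. 1.4 (ii) p. 1669 and Thm. 2.4 p. 1671; ColomboCrippaSorella2023, (1.5) p. 3] -/
theorem MescoliniPitchoSorella2025_thm14.not_hasAnomalousScalarDissipation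
    (h14 : MescoliniPitchoSorella2025_thm14) (h24 : MescoliniPitchoSorella2025_thm24)
    {d : Type} [Fintype d] [DecidableEq d] {T : ℝ} {b : ℝ → UnitAddTorus d → EuclideanSpace ℝ d}
    {ρin : UnitAddTorus d → ℝ} (hT : 0 < T) (hb : MemLp (uncurry b) 2 (Torus.slabMeasure d T))
    (hdiv : ∀ᵐ t ∂(volume.restrict (Ioo 0 T)), Torus.IsWeaklyDivFree (b t))
    (hBV : ∀ a : ℝ, 0 < a → a < T → ∫⁻ t in Icc a T, torusTotalVariation (b t) < ∞)
    (hρin : MemLp ρin ∞ volume) :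
    ¬ Torus.HasAnomalousScalarDissipation T b ρin := by
  classical
  rintro ⟨ε, hε, hfreq⟩
  have hex : ∀ ν : ℝ, 0 < ν → ∃ ρ : ℝ → UnitAddTorus d → ℝ, IsBoundedEnergySolution T ν b ρin ρ := by
    intro ν hν
    obtain ⟨ρ, hρ, -⟩ := (h24 d T ν b ρin hT hν hb hdiv hρin).1
    exact ⟨ρ, hρ⟩
  choose! ϱ hϱ using hex
  have hlim : Tendsto (fun ν => Torus.eScalarDissipation ν (ϱ ν) 0 T) (𝓝[>] 0) (𝓝 0) :=
    (h14 d T b ρin hT hb hdiv hBV hρin).2.2.2 ϱ fun ν hν => hϱ ν hν.1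
  have hev : ∀ᶠ ν in 𝓝[>] (0 : ℝ), Torus.eScalarDissipation ν (ϱ ν) 0 T < ε :=
    hlim.eventually (Iio_mem_nhds hε)
  have hpos : ∀ᶠ ν in 𝓝[>] (0 : ℝ), ν ∈ Ioo (0 : ℝ) 1 := Ioo_mem_nhdsGT one_pos
  obtain ⟨κ, hκP, hκlt, hκpos⟩ := (hfreq.and_eventually (hev.and hpos)).exists
  exact absurd (hκP (ϱ κ) (hϱ κ hκpos.1).isWeakScalarTransportOn) (not_le.2 hκlt)

end

end Literature.Analysis.FluidPDE
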